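import Summits.BirchSwinnertonDyer.Rank1Residual.Additive.GordNonAnomalousFour
import Literature.NumberTheory.EllipticCurves.BSDQuadraticDescentTorsionOddPartProofs
import HarnessLib

/-!
# An anomalous fibre over `𝔽_p` has EXACTLY `p` points (`p ≥ 7`) and `p`-primary part of order `p` (`p ≥ 3`)

HONEST FRAMING (cell `b2b-bsdres`, run/shared/lean/b2b/bsd-rank1-residual/, verbatim in every
file): the goal of the cell is to DELETE the COMBINATION-SHAPED residual classes of the
Birch–Swinnerton-Dyer formula for ALL analytic-rank `≤ 1` elliptic curves over `ℚ` — "full BSD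
formula for every rank `≤ 1` curve in class `C`" assembled STRICTLY from published theorems — so
that the rank-`≤ 1` remainder becomes exactly the CONSTRUCTION-SHAPED classes, which are TYPED
(missing-input `Prop`s), NOT attempted. This is not "finishing BSD". Sub-cell `additive-p2`
(X3♯(G-ord) / X4♯(G-ord)), generation 34, part 3: research route; no claim beyond the stated
classes; theorems only, no definition, no named fact, nothing booked, no label moved.

## What is proved

The factor `#Ẽ_v(k_v)[p^∞]` of Greenberg's Theorem 4.1 (LNM 1716) — squared in the cell's line-V19
inequalities over `ℚ(μ_p)` (additive-p4) and the source of Delbourgo's `ℓ_p(E) ∈ {1, |Tam_p|_p·p²}`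
(J. Number Theory 95 (2002) pp. 39, 69: "since `p ≥ 3` … `#Ĩ(𝔽_p)_{p^∞} = 1` or `p`") — takes only
the values `1` and `p` at a degree-one place, and the value `p` means EXACTLY `p` rational points
once `p ≥ 7`. Elementary (Hasse + Lagrange + Cauchy), but not in the tree before:

* `SpecialJ.natCard_point_lt_sq` — over a field with a prime number `p ≥ 3` of elements,
  `#E(𝔽_p) < p²` (Hasse, the tree's `HasseManin.abs_card_sub_le` via gen 11's integer form);
* **`SpecialJ.natCard_primaryComponent_point_eq_one_or_eq`** — `#E(𝔽_p)[p^∞] ∈ {1, p}` (`p ≥ 3`), and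
  **`SpecialJ.natCard_primaryComponent_point_eq_of_dvd`**: `= p` iff `p ∣ #E(𝔽_p)` (anomalous);
* **`SpecialJ.natCard_point_eq_of_dvd`** — `p ≥ 7` and `p ∣ #E(𝔽_p)` ⟹ **`#E(𝔽_p) = p`** (`a_p = 1`:
  Mazur's definition of an anomalous prime; `a_p ≡ 1 (mod p)` with `|a_p| ≤ 2√p < p − 1`); sharp:
  `y² = x³ − 2x` over `𝔽_5` has `10` points (gen 11);
* number fields: at a good place `w` with `N(w) = p`, `#Ẽ_w(k_w)[p^∞] ∈ {1, p}` (`p ≥ 3`), `= p`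
  exactly on the anomalous places, where `#Ẽ_w(k_w) = p` (`p ≥ 7`)
  (`natCard_primaryComponent_point_reductionAt_eq_one_or_eq`, `…_eq_of_dvd`,
  `natCard_point_reductionAt_eq_of_dvd`);
* the (G)-cell: at every place above `p ≥ 3` of every subfield of `ℚ(ζ_p)` over which `E` is good
  (all of residue degree one), the Greenberg factor is `1` or `p`
  (`natCard_primaryComponent_point_reductionAt_intermediateField_eq_one_or_eq`), so the V19 term
  `2·ord_p #Ẽ(𝔽_p)[p^∞]` is `0` or `2` on every (G-ord) row — `2` exactly on the anomalous rows of
  gen 11's census (X4 190/946, X3 275/334), never `4`.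

References: B. Mazur, Invent. Math. 18 (1972) §5; R. Greenberg, LNM 1716 (1999) Thm. 4.1;
D. Delbourgo, J. Number Theory 95 (2002) pp. 39, 69–70; J. H. Silverman, *AEC* V.1.1 (Hasse).
-/

noncomputable section

open scoped Classical NumberField

open WeierstrassCurve IsDedekindDomain NumberField IsLocalRing Literature.NumberTheory.EllipticCurves

namespace Summit.BirchSwinnertonDyer.Rank1Residual.Additive

namespace SpecialJ

section PrimeField

variable {k : Type*} [Field k] [Finite k] (E : WeierstrassCurve k) [E.IsElliptic] {p : ℕ}

omit [E.IsElliptic] in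
/-- The group of points of a Weierstrass curve over a finite field is finite (the affine points form
a subset of `k × k`). [folklore] -/
theorem finite_point : Finite E.toAffine.Point := by
  have e : E.toAffine.Point ≃ Option {xy : k × k // E.toAffine.Nonsingular xy.1 xy.2} :=
    Affine.nonsingularPointEquiv E.toAffine
  exact Finite.of_equiv _ e.symm

/-- **`#E(𝔽_p) < p²`** for an elliptic curve over a field with a prime number `p ≥ 3` of elements:
Hasse's `(#E − p − 1)² ≤ 4p` (the tree's `HasseManin.abs_card_sub_le`, integer form
`sq_natCard_point_sub_le` of gen 11) and `(p² − p − 1)² > 4p`. [cite: SilvermanAEC2009, Thm. V.1.1] -/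
theorem natCard_point_lt_sq (hp : p.Prime) (hp3 : 3 ≤ p) (hcard : Nat.card k = p) :
    Nat.card E.toAffine.Point < p ^ 2 := by
  haveI := Fintype.ofFinite k
  obtain ⟨-, hq⟩ := ringChar_eq_of_natCard_eq (k := k) hp hcard
  have hsq := sq_natCard_point_sub_le E
  rw [hq] at hsq
  by_contra hge
  rw [not_lt] at hge
  have hgeZ : (p : ℤ) ^ 2 ≤ Nat.card E.toAffine.Point := by exact_mod_cast hge
  have hp3Z : (3 : ℤ) ≤ p := by exact_mod_cast hp3
  have hs : (p : ℤ) ^ 2 - p - 1 ≤ (Nat.card E.toAffine.Point : ℤ) - (p + 1) := by linarith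
  have h2 : 2 * (p : ℤ) - 1 ≤ (p : ℤ) ^ 2 - p - 1 := by nlinarith
  have hs0 : (0 : ℤ) ≤ (p : ℤ) ^ 2 - p - 1 := by linarith
  have hmul := mul_le_mul hs hs hs0 (le_trans hs0 hs)
  have h2' := mul_le_mul h2 h2 (by linarith) hs0
  nlinarith

/-- `v_p(#E(𝔽_p)) ≤ 1` (`p ≥ 3`): `#E(𝔽_p) < p²` and `#E(𝔽_p) > 0`. [folklore] -/
theorem padicValNat_natCard_point_le_one (hp : p.Prime) (hp3 : 3 ≤ p) (hcard : Nat.card k = p) :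
    padicValNat p (Nat.card E.toAffine.Point) ≤ 1 := by
  haveI : Fact p.Prime := ⟨hp⟩
  haveI := finite_point E
  have hlt := natCard_point_lt_sq E hp hp3 hcard
  have hpos : 0 < Nat.card E.toAffine.Point := Nat.card_pos
  by_contra h
  rw [not_le] at h
  have hdvd : p ^ 2 ∣ Nat.card E.toAffine.Point := (padicValNat_dvd_iff_le hpos.ne').mpr (by omega)
  exact absurd (Nat.le_of_dvd hpos hdvd) (not_le.mpr hlt)

/-- **`#E(𝔽_p)[p^∞] = p` on an anomalous curve** (`p ≥ 3`, `p ∣ #E(𝔽_p)`): the `p`-primary part of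
`E(𝔽_p)` has order `p^{v_p(#E)}` (the tree's `natCard_primaryComponent_eq_pow_padicValNat`) and
`v_p(#E(𝔽_p)) = 1`. Delbourgo 2002 p. 69 ("`#Ĩ(𝔽_p)_{p^∞} = 1` or `p`"). [cite: Delbourgo2002, p. 69] -/
theorem natCard_primaryComponent_point_eq_of_dvd (hp : p.Prime) (hp3 : 3 ≤ p) (hcard : Nat.card k = p)
    (hdvd : p ∣ Nat.card E.toAffine.Point) :
    Nat.card (AddCommGroup.primaryComponent E.toAffine.Point p) = p := by
  haveI : Fact p.Prime := ⟨hp⟩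
  haveI := finite_point E
  have hpos : 0 < Nat.card E.toAffine.Point := Nat.card_pos
  have h1 : 1 ≤ padicValNat p (Nat.card E.toAffine.Point) :=
    (padicValNat_dvd_iff_le hpos.ne').mp (by rwa [pow_one])
  have hv : padicValNat p (Nat.card E.toAffine.Point) = 1 :=
    le_antisymm (padicValNat_natCard_point_le_one E hp hp3 hcard) h1
  rw [natCard_primaryComponent_eq_pow_padicValNat p, hv, pow_one]

/-- **The dichotomy `#E(𝔽_p)[p^∞] ∈ {1, p}`** for every elliptic curve over `𝔽_p`, `p ≥ 3`
(`= p` iff `p ∣ #E(𝔽_p)`). Delbourgo 2002 p. 69. [cite: Delbourgo2002, p. 69] -/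
theorem natCard_primaryComponent_point_eq_one_or_eq (hp : p.Prime) (hp3 : 3 ≤ p)
    (hcard : Nat.card k = p) :
    Nat.card (AddCommGroup.primaryComponent E.toAffine.Point p) = 1 ∨
      Nat.card (AddCommGroup.primaryComponent E.toAffine.Point p) = p := by
  haveI : Fact p.Prime := ⟨hp⟩
  haveI := finite_point E
  by_cases hdvd : p ∣ Nat.card E.toAffine.Point
  · exact Or.inr (natCard_primaryComponent_point_eq_of_dvd E hp hp3 hcard hdvd)
  · left
    rw [natCard_primaryComponent_eq_pow_padicValNat p, padicValNat.eq_zero_of_not_dvd hdvd, pow_zero]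

/-- **An anomalous curve over `𝔽_p`, `p ≥ 7`, has EXACTLY `p` points** (`a_p = 1`, Mazur's anomalous
condition): `#E = p·c`, and Hasse's `(pc − p − 1)² ≤ 4p` excludes `c = 0` and `c ≥ 2` once `p ≥ 7`.
Sharp: `#E(𝔽_5) = 10` for `y² = x³ − 2x`. [cite: SilvermanAEC2009, Thm. V.1.1] -/
theorem natCard_point_eq_of_dvd (hp : p.Prime) (hp7 : 7 ≤ p) (hcard : Nat.card k = p)
    (hdvd : p ∣ Nat.card E.toAffine.Point) : Nat.card E.toAffine.Point = p := by
  haveI := Fintype.ofFinite k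
  obtain ⟨-, hq⟩ := ringChar_eq_of_natCard_eq (k := k) hp hcard
  have hsq := sq_natCard_point_sub_le E
  rw [hq] at hsq
  obtain ⟨c, hc⟩ := hdvd
  rw [hc] at hsq ⊢
  push_cast at hsq
  have hp7Z : (7 : ℤ) ≤ p := by exact_mod_cast hp7
  rcases c with _ | c
  · exfalso
    simp only [Nat.cast_zero, mul_zero, zero_sub] at hsq
    nlinarith
  rcases c with _ | c
  · simp
  · exfalso
    push_cast at hsq
    have hc0 : (0 : ℤ) ≤ c := by exact_mod_cast Nat.zero_le c
    have ht : (p : ℤ) - 1 ≤ (p : ℤ) * ((c : ℤ) + 1 + 1) - (p + 1) := by nlinarith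
    have ht0 : (0 : ℤ) ≤ (p : ℤ) - 1 := by linarith
    have hsq' : ((p : ℤ) - 1) * ((p : ℤ) - 1) ≤ ((p : ℤ) * ((c : ℤ) + 1 + 1) - (p + 1)) ^ 2 := by
      rw [sq]; exact mul_le_mul ht ht ht0 (le_trans ht0 ht)
    nlinarith

end PrimeField

end SpecialJ

/-! ### Number fields: degree-one good places -/

section NumberFieldPlace

variable {F : Type} [Field F] [NumberField F] (V : WeierstrassCurve F)
  (w : HeightOneSpectrum (𝓞 F)) {p : ℕ}

/-- **Greenberg's factor at a degree-one good place is `1` or `p`**: for `V/F` good at `w` with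
`N(w) = p ≥ 3`, `#Ṽ_w(k_w)[p^∞] ∈ {1, p}`. [cite: GreenbergLNM1716, Thm. 4.1] [cite: Delbourgo2002, p. 69] -/
theorem natCard_primaryComponent_point_reductionAt_eq_one_or_eq (hp : p.Prime) (hp3 : 3 ≤ p)
    (hN : Ideal.absNorm w.asIdeal = p) (hgood : V.HasGoodReductionAt w) :
    Nat.card (AddCommGroup.primaryComponent (V.reductionAt w).toAffine.Point p) = 1 ∨
      Nat.card (AddCommGroup.primaryComponent (V.reductionAt w).toAffine.Point p) = p := by
  haveI : (V.reductionAt w).IsElliptic := isElliptic_reductionAt hgood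
  exact SpecialJ.natCard_primaryComponent_point_eq_one_or_eq (V.reductionAt w) hp hp3
    (natCard_residueField_adicCompletionIntegers_eq_of_absNorm w hN)

/-- At an ANOMALOUS degree-one good place (`p ∣ #Ṽ_w(k_w)`, `N(w) = p ≥ 3`): `#Ṽ_w(k_w)[p^∞] = p`
exactly. [cite: GreenbergLNM1716, Thm. 4.1] [cite: Delbourgo2002, p. 69] -/
theorem natCard_primaryComponent_point_reductionAt_eq_of_dvd (hp : p.Prime) (hp3 : 3 ≤ p)
    (hN : Ideal.absNorm w.asIdeal = p) (hgood : V.HasGoodReductionAt w)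
    (hdvd : p ∣ Nat.card (V.reductionAt w).toAffine.Point) :
    Nat.card (AddCommGroup.primaryComponent (V.reductionAt w).toAffine.Point p) = p := by
  haveI : (V.reductionAt w).IsElliptic := isElliptic_reductionAt hgood
  exact SpecialJ.natCard_primaryComponent_point_eq_of_dvd (V.reductionAt w) hp hp3
    (natCard_residueField_adicCompletionIntegers_eq_of_absNorm w hN) hdvd

/-- At an anomalous degree-one good place with `p ≥ 7`: `#Ṽ_w(k_w) = p` exactly (`a_w = 1`).
[cite: SilvermanAEC2009, Thm. V.1.1] -/
theorem natCard_point_reductionAt_eq_of_dvd (hp : p.Prime) (hp7 : 7 ≤ p)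
    (hN : Ideal.absNorm w.asIdeal = p) (hgood : V.HasGoodReductionAt w)
    (hdvd : p ∣ Nat.card (V.reductionAt w).toAffine.Point) :
    Nat.card (V.reductionAt w).toAffine.Point = p := by
  haveI : (V.reductionAt w).IsElliptic := isElliptic_reductionAt hgood
  exact SpecialJ.natCard_point_eq_of_dvd (V.reductionAt w) hp hp7
    (natCard_residueField_adicCompletionIntegers_eq_of_absNorm w hN) hdvd

end NumberFieldPlace

/-! ### The (G)-cell: every place above `p` of every subfield of `ℚ(ζ_p)` -/

section Gord

variable (W : WeierstrassCurve ℚ) (p : ℕ) [hp : Fact p.Prime]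

/-- **On every (G)-field the Greenberg factor is `1` or `p`.** For `W/ℚ`, `p ≥ 3`, a subfield `F`
of a `p`-th cyclotomic field and a place `w ∋ p` of `F` (residue degree one,
`absNorm_eq_of_intermediateField_cyclotomic`) at which `E_F` is good:
`#Ẽ_w(𝔽_p)[p^∞] ∈ {1, p}` — the term `2·ord_p #Ẽ_w(𝔽_p)[p^∞]` of the cell's line-V19 inequalities is
`0` or `2`, never more. [cite: GreenbergLNM1716, Thm. 4.1] [cite: Delbourgo2002, p. 69] -/
theorem natCard_primaryComponent_point_reductionAt_intermediateField_eq_one_or_eq (hp3 : 3 ≤ p)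
    {L : Type} [Field L] [NumberField L] [IsCyclotomicExtension {p} ℚ L] (F : IntermediateField ℚ L)
    (w : HeightOneSpectrum (𝓞 F)) (hw : (p : 𝓞 F) ∈ w.asIdeal)
    (hgood : (W.baseChange F).HasGoodReductionAt w) :
    Nat.card (AddCommGroup.primaryComponent ((W.baseChange F).reductionAt w).toAffine.Point p) = 1 ∨
      Nat.card (AddCommGroup.primaryComponent ((W.baseChange F).reductionAt w).toAffine.Point p) = p := by
  haveI : NumberField F := NumberField.of_module_finite ℚ F
  haveI : w.asIdeal.LiesOver (Ideal.span {(p : ℤ)}) := Ideal.liesOver_span_of_natCast_mem' hp.out hw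
  exact natCard_primaryComponent_point_reductionAt_eq_one_or_eq (W.baseChange F) w hp.out hp3
    (absNorm_eq_of_intermediateField_cyclotomic p F w) hgood

/-- **On an ANOMALOUS (G)-field place the Greenberg factor is EXACTLY `p`, and for `p ≥ 7` the
fibre has exactly `p` points** (`a_w = 1`; census: the 54 anomalous defect-`3`/`6` rows at
`p ∈ {7, 19}` all have `a_𝔭 = 1`). [cite: GreenbergLNM1716, Thm. 4.1] [cite: SilvermanAEC2009, Thm. V.1.1] -/
theorem natCard_primaryComponent_point_reductionAt_intermediateField_eq_of_dvd (hp7 : 7 ≤ p)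
    {L : Type} [Field L] [NumberField L] [IsCyclotomicExtension {p} ℚ L] (F : IntermediateField ℚ L)
    (w : HeightOneSpectrum (𝓞 F)) (hw : (p : 𝓞 F) ∈ w.asIdeal)
    (hgood : (W.baseChange F).HasGoodReductionAt w)
    (hdvd : p ∣ Nat.card ((W.baseChange F).reductionAt w).toAffine.Point) :
    Nat.card (AddCommGroup.primaryComponent ((W.baseChange F).reductionAt w).toAffine.Point p) = p ∧
      Nat.card ((W.baseChange F).reductionAt w).toAffine.Point = p := by
  haveI : NumberField F := NumberField.of_module_finite ℚ F
  haveI : w.asIdeal.LiesOver (Ideal.span {(p : ℤ)}) := Ideal.liesOver_span_of_natCast_mem' hp.out hw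
  have hN := absNorm_eq_of_intermediateField_cyclotomic p F w
  exact ⟨natCard_primaryComponent_point_reductionAt_eq_of_dvd (W.baseChange F) w hp.out (by omega) hN
      hgood hdvd,
    natCard_point_reductionAt_eq_of_dvd (W.baseChange F) w hp.out hp7 hN hgood hdvd⟩

end Gord

end Summit.BirchSwinnertonDyer.Rank1Residual.Additive

end
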